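import Summits.BirchSwinnertonDyer.BirchSwinnertonDyer.Theorems.ManinLocalTwoThreeEtaLimitsFortyFour
import Summits.BirchSwinnertonDyer.BirchSwinnertonDyer.Theorems.ManinLocalTwoThreeCubicCertificateFortyFour
import Summits.BirchSwinnertonDyer.BirchSwinnertonDyer.Theorems.ManinLocalTwoThreeAnalyticBridge
import Literature.NumberTheory.EllipticCurves.ModularCurveSturmProofs
import HarnessLib

/-!
# The `η`-identities of `X₀(44) → 44a1` EXACTLY — (I2a) `X′ = −2πiΦ₄₄·2Y`, (I2b) `Y′ = −2πiΦ₄₄·(3X² + 8/3)`,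
# (I1) `Y² = X³ + (8/3)X − 52/27` on `ℍ` — and (S2)₄₄: `Λ(φ) ⊆ Λ(−32/3, 208/27)` for every `φ ∈ S₂(Γ₀(44))` with `⇑φ = Φ₄₄`

Cell `bsd-f2-manin`, route `ManinLocalTwoThree`, crux C2 `ManinOddAtFour` (stmt-BirchSwinnertonDyer-22967: `2² ∣ 44`, genus `4`),
LEAD p1 gen 24; `--supports stmt-BirchSwinnertonDyer-22967` (helper).  Objects: `u = η₂²η₂₂²/(η₄²η₄₄²)`, `v = η₂⁶η₂₂⁶/(η₁²η₄⁴η₁₁²η₄₄⁴)`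
(`…EtaCoordinatesFortyFour`), `X = 4/3 + u`, `Y = −2 + v − 2u` (the Weierstrass coordinates `(℘, ℘′/2)` of the optimal curve
`44a1 = [0, 1, 0, 3, −1]`, `(g₂, g₃) = (c₄/12, c₆/216) = (−32/3, 208/27)`, pulled back to `X₀(44)`; poles only on the fibre `{∞, 1/4}`),
and the pinned newform `Φ₄₄` (`NewformPinningFortyFour.f_apply_eq_phi44`: `⇑D.f = ⇑Φ₄₄` for EVERY `X₀(44)`-datum, fact-free).

THE E₂ ROAD (p3 g24's device, `EtaLogDerivativeForms`; no expansion at the cusp `1/4`): `u′ = (πi/12)G_u·u`, `v′ = (πi/12)G_v·v` with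
`G_u, G_v ∈ M₂(Γ₀(44))` (`…EisensteinPhiFortyFour`); multiplying (I2a) `G_u·u = −48Φ₄₄Y` and (I2b) `G_v·v − 2G_u·u = −Φ₄₄(192 + 192u + 72u²)`
by `P4 = η₄²η₄₄² ∈ M₂(Γ₀(44))` (`u·P4 = P2`, `v·P4 = V1`, `u²·P4 = U2`, `…EtaWeightTwoFormsFortyFour`) turns them into the vanishing
of two forms of `M₄(Γ₀(44))`, settled by Sturm's bound (`4·72/12 = 24 < 33`, tree `coe_eq_zero_of_isBigO_exp'`) from the limits
(L1)₄₄, (L2)₄₄ of `…EtaLimitsFortyFour`.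

* §0 bookkeeping `P2 = u·P4`, `V1 = v·P4`, `U2 = u²·P4`; Sturm in `M₄(Γ₀(44))`;
* §1 (I2a)₄₄ `deriv_X_fortyFour`, (I2b)₄₄ `deriv_Y_fortyFour`;
* §2 (L3)₄₄ `Y² − X³ − (8/3)X + 52/27 → 0` at `i∞` (from the kernel certificate `tendsto_cubicDefect44`) and (I1)₄₄ `cubic_fortyFour`
  (the derivative of the defect vanishes by (I2a), (I2b); `ℍ` is connected);
* §3 (S2)₄₄ `periodLatticeLe_fortyFour`: `(X′)² = (2πiφ)²(4X³ + (32/3)X − 208/27)`, `X` holomorphic and `Γ₀(44)`-invariant on `ℍ`,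
  non-degenerate (`q³Y → 1`), so by the analytic bridge every period of `φ` lies in `Λ(−32/3, 208/27)`.

HONEST FRAMING: unconditional (standard axioms); nothing here proves C2 (all `N`), Manin's conjecture or BSD; item 22967 stays OPEN.
No definition, no named fact, no sorry. [cite: Ligozat1975, Ch. 3–4] [cite: Zagier2008, §2.3] [cite: DiamondShurman2005, Thm. 3.5.1]
[cite: CremonaAlgorithms1997, §2.10 and Table 1 (44a1)]
-/

set_option autoImplicit false
-- lint-debt: the directory name repeats the summit name (sibling precedent `ManinLocalTwoThreeEtaIdentitiesSeventyTwo.lean`)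
set_option linter.dupNamespace false

noncomputable section

open Complex Filter Topology Set Asymptotics Polynomial EisensteinSeries
open UpperHalfPlane hiding I
open scoped Real Topology Manifold MatrixGroups ModularForm
open ModularForm CongruenceSubgroup SlashInvariantForm
open Literature.NumberTheory.ModularForms
open Literature.NumberTheory.EllipticCurves Literature.NumberTheory.EllipticCurves.ModularForms

namespace Summit.BirchSwinnertonDyer.BirchSwinnertonDyer.Theorems.ManinLocalTwoThree.LevelFortyFour

open QRemainder EtaLogDerivativeForms AnalyticBridge

/-! ## §0 Bookkeeping and Sturm's bound in `M₄(Γ₀(44))` -/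

/-- `u₄₄ = (E₂²E₂₂²/(E₄²E₄₄²))/q²` through the Euler functions. [cite: Koehler2011, §2.1] -/
theorem u44_eq_div (τ : ℍ) :
    etaQuotient 44 rU44 τ = (eulerFn 2 τ * eulerFn 2 τ * ((eulerFn 4 τ)⁻¹ * (eulerFn 4 τ)⁻¹) * (eulerFn 22 τ * eulerFn 22 τ)
      * ((eulerFn 44 τ)⁻¹ * (eulerFn 44 τ)⁻¹)) / Function.Periodic.qParam 1 (τ : ℂ) ^ 2 := by
  rw [eq_div_iff (pow_ne_zero _ (qParam_ne_zero τ)), mul_comm]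
  exact qpow_mul_u44 τ

/-- `v₄₄ = (E₂⁶E₂₂⁶/(E₁²E₄⁴E₁₁²E₄₄⁴))/q³` through the Euler functions. [cite: Koehler2011, §2.1] -/
theorem v44_eq_div (τ : ℍ) :
    etaQuotient 44 rV44 τ = ((eulerFn 1 τ)⁻¹ * (eulerFn 1 τ)⁻¹ * (eulerFn 2 τ * eulerFn 2 τ * eulerFn 2 τ
      * (eulerFn 2 τ * eulerFn 2 τ * eulerFn 2 τ)) * ((eulerFn 4 τ)⁻¹ * (eulerFn 4 τ)⁻¹ * ((eulerFn 4 τ)⁻¹ * (eulerFn 4 τ)⁻¹))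
      * ((eulerFn 11 τ)⁻¹ * (eulerFn 11 τ)⁻¹) * (eulerFn 22 τ * eulerFn 22 τ * eulerFn 22 τ * (eulerFn 22 τ * eulerFn 22 τ * eulerFn 22 τ))
      * ((eulerFn 44 τ)⁻¹ * (eulerFn 44 τ)⁻¹ * ((eulerFn 44 τ)⁻¹ * (eulerFn 44 τ)⁻¹))) / Function.Periodic.qParam 1 (τ : ℂ) ^ 3 := by
  rw [eq_div_iff (pow_ne_zero _ (qParam_ne_zero τ)), mul_comm]
  exact qpow_mul_v44 τ

/-- **`P2 = u·P4`, `V1 = v·P4`, `U2 = u²·P4` on `ℍ`** (`η`-exponent bookkeeping). [folklore] -/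
theorem forms_eq_mul_P4 (τ : ℍ) :
    P2 τ = etaQuotient 44 rU44 τ * P4 τ ∧ V1 τ = etaQuotient 44 rV44 τ * P4 τ ∧
      U2 τ = etaQuotient 44 rU44 τ ^ 2 * P4 τ := by
  have hE1 := eulerFn_ne_zero (by norm_num : 0 < 1) τ
  have hE2 := eulerFn_ne_zero (by norm_num : 0 < 2) τ
  have hE4 := eulerFn_ne_zero (by norm_num : 0 < 4) τ
  have hE11 := eulerFn_ne_zero (by norm_num : 0 < 11) τ
  have hE22 := eulerFn_ne_zero (by norm_num : 0 < 22) τ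
  have hE44 := eulerFn_ne_zero (by norm_num : 0 < 44) τ
  have hq := qParam_ne_zero τ
  rw [u44_eq_div, v44_eq_div, P2_apply, P4_apply, V1_apply, U2_apply]
  simp only [zpow_neg, zpow_ofNat]
  refine ⟨?_, ?_, ?_⟩ <;> field_simp

/-- `P4` does not vanish on `ℍ`. [folklore] -/
theorem P4_ne_zero (τ : ℍ) : P4 τ ≠ 0 := etaQuotient_ne_zero 44 rP4 τ

/-- **Sturm's bound in `M₄(Γ₀(44))`: `F/q³³ → 0` at `i∞` forces `F = 0`** (`⌊4·72/12⌋ = 24 < 33`). [cite: DiamondShurman2005, Thm. 3.5.1] -/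
theorem modularForm_fortyFour_four_eq_zero_of_tendsto (F : ModularForm (Gamma0 44) (2 + 2))
    (h : Tendsto (fun τ : ℍ ↦ F τ / Function.Periodic.qParam 1 (τ : ℂ) ^ 33) atImInfty (𝓝 0)) : (⇑F) = 0 := by
  have hcard : Nat.card (𝒮ℒ ⧸ ((Gamma0 44 : Subgroup SL(2, ℤ)) : Subgroup (GL (Fin 2) ℝ)).subgroupOf 𝒮ℒ) = 72 := by
    rw [card_quotient_subgroupOf_eq_index]
    have h1 := index_gamma0_eq_gamma0Index_holds 44
    unfold index_gamma0_eq_gamma0Index at h1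
    rw [h1, gamma0_data_44.1]
  refine coe_eq_zero_of_isBigO_exp' F (m := 33) ?_ (by
    rw [hcard]
    simp only [Int.reduceAdd, Int.reduceMul, Int.reduceToNat, Nat.reduceDiv, Nat.cast_ofNat]
    norm_num)
  have h1 : (fun τ : ℍ ↦ F τ / Function.Periodic.qParam 1 (τ : ℂ) ^ 33) =O[atImInfty] fun _ : ℍ ↦ (1 : ℝ) := h.isBigO_one ℝ
  have h2 : (fun τ : ℍ ↦ Function.Periodic.qParam 1 (τ : ℂ) ^ 33) =O[atImInfty] fun τ : ℍ ↦ Real.exp (-2 * π * 33 * τ.im) := by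
    refine Asymptotics.IsBigO.of_bound 1 (Filter.Eventually.of_forall fun τ ↦ ?_)
    rw [norm_pow, Function.Periodic.norm_qParam, Real.norm_eq_abs, abs_of_pos (Real.exp_pos _), one_mul,
      ← Real.exp_nat_mul, UpperHalfPlane.coe_im]
    apply le_of_eq
    congr 1
    push_cast
    ring
  have h3 := h1.mul h2
  simp only [one_mul] at h3
  refine h3.congr' (Filter.Eventually.of_forall fun τ ↦ ?_) Filter.EventuallyEq.rfl
  exact div_mul_cancel₀ _ (pow_ne_zero _ (qParam_ne_zero τ))

/-! ## §1 (I2a)₄₄ and (I2b)₄₄ -/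

/-- **`G_u·u + 48Φ₄₄·Y = 0` on `ℍ`** (`Y = −2 + v − 2u`): Sturm on `T_a = G_u·P2 + 48Φ₄₄(V1 − 2P4 − 2P2) = P4·(G_u u + 48Φ₄₄Y) ∈ M₄(Γ₀(44))`,
(L1)₄₄. [cite: DiamondShurman2005, Thm. 3.5.1] -/
theorem Gu_identity (τ : ℍ) :
    (4 * E2 (sixMulPt 2 τ) - 8 * E2 (sixMulPt 4 τ) + 44 * E2 (sixMulPt 22 τ) - 88 * E2 (sixMulPt 44 τ)) * etaQuotient 44 rU44 τ
      + 48 * Phi44 τ * (-2 + etaQuotient 44 rV44 τ - 2 * etaQuotient 44 rU44 τ) = 0 := by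
  obtain ⟨G, hG⟩ := exists_modularForm_Gu
  set T : ModularForm (Gamma0 44) (2 + 2) := G.mul P2 + (48 : ℂ) • (Phi44.mul (V1 - (2 : ℂ) • P4 - (2 : ℂ) • P2)) with hT
  have hTapply : ∀ σ : ℍ, T σ = ((4 : ℂ) * E2 (sixMulPt 2 σ) - ((8 : ℂ) * E2 (sixMulPt 4 σ)) + (44 : ℂ) * E2 (sixMulPt 22 σ) - ((88 : ℂ) * E2 (sixMulPt 44 σ))) * P2 σ + (48 : ℂ) * (Phi44 σ * (V1 σ - ((2 : ℂ) * P4 σ) - ((2 : ℂ) * P2 σ))) := by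
    intro σ
    simp only [hT, ModularForm.add_apply, ModularForm.coe_mul, Pi.mul_apply, ModularForm.IsGLPos.smul_apply,
      ModularForm.sub_apply, smul_eq_mul, hG σ]
  have hT0 : (⇑T) = 0 := modularForm_fortyFour_four_eq_zero_of_tendsto T (tendsto_La_fortyFour.congr fun σ ↦ by rw [hTapply σ])
  have e := congrFun hT0 τ
  rw [hTapply τ, Pi.zero_apply] at e
  obtain ⟨h1, h2, -⟩ := forms_eq_mul_P4 τ
  rw [h1, h2] at e
  have hP4 := P4_ne_zero τ
  have e' : P4 τ * ((4 * E2 (sixMulPt 2 τ) - 8 * E2 (sixMulPt 4 τ) + 44 * E2 (sixMulPt 22 τ) - 88 * E2 (sixMulPt 44 τ))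
      * etaQuotient 44 rU44 τ + 48 * Phi44 τ * (-2 + etaQuotient 44 rV44 τ - 2 * etaQuotient 44 rU44 τ)) = 0 := by
    linear_combination e
  exact (mul_eq_zero.mp e').resolve_left hP4

/-- **`G_v·v − 2G_u·u + Φ₄₄·(192 + 192u + 72u²) = 0` on `ℍ`**: Sturm on `T_b = G_v·V1 − 2G_u·P2 + Φ₄₄(192P4 + 192P2 + 72U2) ∈ M₄(Γ₀(44))`,
(L2)₄₄. [cite: DiamondShurman2005, Thm. 3.5.1] -/
theorem Gv_identity (τ : ℍ) :
    (-2 * E2 (sixMulPt 1 τ) + 12 * E2 (sixMulPt 2 τ) - 16 * E2 (sixMulPt 4 τ) - 22 * E2 (sixMulPt 11 τ) + 132 * E2 (sixMulPt 22 τ)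
        - 176 * E2 (sixMulPt 44 τ)) * etaQuotient 44 rV44 τ
      - 2 * ((4 * E2 (sixMulPt 2 τ) - 8 * E2 (sixMulPt 4 τ) + 44 * E2 (sixMulPt 22 τ) - 88 * E2 (sixMulPt 44 τ)) * etaQuotient 44 rU44 τ)
      + Phi44 τ * (192 + 192 * etaQuotient 44 rU44 τ + 72 * etaQuotient 44 rU44 τ ^ 2) = 0 := by
  obtain ⟨G, hG⟩ := exists_modularForm_Gu
  obtain ⟨Gv, hGv⟩ := exists_modularForm_Gv
  set T : ModularForm (Gamma0 44) (2 + 2) :=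
    Gv.mul V1 - (2 : ℂ) • (G.mul P2) + Phi44.mul ((192 : ℂ) • P4 + (192 : ℂ) • P2 + (72 : ℂ) • U2) with hT
  have hTapply : ∀ σ : ℍ, T σ = ((-2 : ℂ) * E2 (sixMulPt 1 σ) + (12 : ℂ) * E2 (sixMulPt 2 σ) - ((16 : ℂ) * E2 (sixMulPt 4 σ)) - ((22 : ℂ) * E2 (sixMulPt 11 σ)) + (132 : ℂ) * E2 (sixMulPt 22 σ) - ((176 : ℂ) * E2 (sixMulPt 44 σ))) * V1 σ - ((2 : ℂ) * (((4 : ℂ) * E2 (sixMulPt 2 σ) - ((8 : ℂ) * E2 (sixMulPt 4 σ)) + (44 : ℂ) * E2 (sixMulPt 22 σ) - ((88 : ℂ) * E2 (sixMulPt 44 σ))) * P2 σ)) + Phi44 σ * ((192 : ℂ) * P4 σ + (192 : ℂ) * P2 σ + (72 : ℂ) * U2 σ) := by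
    intro σ
    simp only [hT, ModularForm.add_apply, ModularForm.sub_apply, ModularForm.coe_mul, Pi.mul_apply, ModularForm.IsGLPos.smul_apply,
      smul_eq_mul, hG σ, hGv σ]
  have hT0 : (⇑T) = 0 := modularForm_fortyFour_four_eq_zero_of_tendsto T (tendsto_Lb_fortyFour.congr fun σ ↦ by rw [hTapply σ])
  have e := congrFun hT0 τ
  rw [hTapply τ, Pi.zero_apply] at e
  obtain ⟨h1, h2, h3⟩ := forms_eq_mul_P4 τ
  rw [h1, h2, h3] at e
  have hP4 := P4_ne_zero τ
  have e' : P4 τ * ((-2 * E2 (sixMulPt 1 τ) + 12 * E2 (sixMulPt 2 τ) - 16 * E2 (sixMulPt 4 τ) - 22 * E2 (sixMulPt 11 τ)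
        + 132 * E2 (sixMulPt 22 τ) - 176 * E2 (sixMulPt 44 τ)) * etaQuotient 44 rV44 τ
      - 2 * ((4 * E2 (sixMulPt 2 τ) - 8 * E2 (sixMulPt 4 τ) + 44 * E2 (sixMulPt 22 τ) - 88 * E2 (sixMulPt 44 τ)) * etaQuotient 44 rU44 τ)
      + Phi44 τ * (192 + 192 * etaQuotient 44 rU44 τ + 72 * etaQuotient 44 rU44 τ ^ 2)) = 0 := by
    linear_combination e
  exact (mul_eq_zero.mp e').resolve_left hP4

/-- **(I2a)₄₄: `X′ = −2πi Φ₄₄ · 2Y` on `ℍ`** (`X = 4/3 + u`, `Y = −2 + v − 2u`; `u′ = (πi/12)G_u·u`, `G_u·u = −48Φ₄₄Y`).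
[cite: Ligozat1975, Ch. 4] [cite: Zagier2008, §2.3] -/
theorem deriv_X_fortyFour (τ : ℍ) :
    deriv ((fun σ : ℍ ↦ (4 / 3 : ℂ) + etaQuotient 44 rU44 σ) ∘ ofComplex) τ
      = -(2 * π * I * Phi44 τ) * (2 * (-2 + etaQuotient 44 rV44 τ - 2 * etaQuotient 44 rU44 τ)) := by
  have hfun : ((fun σ : ℍ ↦ (4 / 3 : ℂ) + etaQuotient 44 rU44 σ) ∘ ofComplex) = fun z ↦ (4 / 3 : ℂ) + (etaQuotient 44 rU44 ∘ ofComplex) z := by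
    funext z
    simp only [Function.comp_apply]
  rw [hfun, deriv_const_add, deriv_etaQuotient_eq_e2Comb 44 rU44 τ, e2Comb_u_eq τ]
  linear_combination (π * I / 12) * Gu_identity τ

/-- `u ∘ ofComplex` and `v ∘ ofComplex` have derivatives `(πi/12)G_u u`, `(πi/12)G_v v` AT `τ` (as `HasDerivAt`). [cite: Zagier2008, §2.3] -/
theorem hasDerivAt_u_v (τ : ℍ) :
    HasDerivAt (etaQuotient 44 rU44 ∘ ofComplex)
      ((π * I / 12) * (4 * E2 (sixMulPt 2 τ) - 8 * E2 (sixMulPt 4 τ) + 44 * E2 (sixMulPt 22 τ) - 88 * E2 (sixMulPt 44 τ))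
        * etaQuotient 44 rU44 τ) (τ : ℂ) ∧
    HasDerivAt (etaQuotient 44 rV44 ∘ ofComplex)
      ((π * I / 12) * (-2 * E2 (sixMulPt 1 τ) + 12 * E2 (sixMulPt 2 τ) - 16 * E2 (sixMulPt 4 τ) - 22 * E2 (sixMulPt 11 τ)
        + 132 * E2 (sixMulPt 22 τ) - 176 * E2 (sixMulPt 44 τ)) * etaQuotient 44 rV44 τ) (τ : ℂ) := by
  have hU := UpperHalfPlane.mdifferentiable_iff.mp (mdifferentiable_etaQuotient 44 rU44)
  have hV := UpperHalfPlane.mdifferentiable_iff.mp (mdifferentiable_etaQuotient 44 rV44)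
  have h1 : HasDerivAt (etaQuotient 44 rU44 ∘ ofComplex) (deriv (etaQuotient 44 rU44 ∘ ofComplex) τ) (τ : ℂ) :=
    ((hU τ τ.im_pos).differentiableAt (isOpen_upperHalfPlaneSet.mem_nhds τ.im_pos)).hasDerivAt
  have h2 : HasDerivAt (etaQuotient 44 rV44 ∘ ofComplex) (deriv (etaQuotient 44 rV44 ∘ ofComplex) τ) (τ : ℂ) :=
    ((hV τ τ.im_pos).differentiableAt (isOpen_upperHalfPlaneSet.mem_nhds τ.im_pos)).hasDerivAt
  rw [deriv_etaQuotient_eq_e2Comb 44 rU44 τ, e2Comb_u_eq τ] at h1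
  rw [deriv_etaQuotient_eq_e2Comb 44 rV44 τ, e2Comb_v_eq τ] at h2
  exact ⟨h1, h2⟩

/-- **(I2b)₄₄: `Y′ = −2πi Φ₄₄ · (3X² + 8/3)` on `ℍ`** (`Y′ = v′ − 2u′ = (πi/12)(G_v v − 2G_u u) = −(πi/12)Φ₄₄(72X² + 64)`).
[cite: Ligozat1975, Ch. 4] [cite: Zagier2008, §2.3] -/
theorem deriv_Y_fortyFour (τ : ℍ) :
    deriv ((fun σ : ℍ ↦ -2 + etaQuotient 44 rV44 σ - 2 * etaQuotient 44 rU44 σ) ∘ ofComplex) τ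
      = -(2 * π * I * Phi44 τ) * (3 * ((4 / 3 : ℂ) + etaQuotient 44 rU44 τ) ^ 2 + 8 / 3) := by
  obtain ⟨h1, h2⟩ := hasDerivAt_u_v τ
  have hY := (h2.const_add (-2 : ℂ)).sub (h1.const_mul (2 : ℂ))
  have hfun : ((fun σ : ℍ ↦ -2 + etaQuotient 44 rV44 σ - 2 * etaQuotient 44 rU44 σ) ∘ ofComplex)
      = ((fun z ↦ -2 + (etaQuotient 44 rV44 ∘ ofComplex) z) - fun z ↦ 2 * (etaQuotient 44 rU44 ∘ ofComplex) z) := by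
    funext z
    simp only [Function.comp_apply, Pi.sub_apply]
  rw [hfun, hY.deriv]
  linear_combination (π * I / 12) * Gv_identity τ

/-! ## §2 (L3)₄₄ and (I1)₄₄ `Y² = X³ + (8/3)X − 52/27` on `ℍ` -/

/-- **(L3)₄₄: `Y² − X³ − (8/3)X + 52/27 → 0` at `i∞`** — from the kernel certificate `tendsto_cubicDefect44`
(`27q⁶·(X³ + (8/3)X − 52/27 − Y²) = o(q³³)`). [cite: CremonaAlgorithms1997, Table 1 (44a1)] -/
theorem tendsto_cubicLimit_fortyFour :
    Tendsto (fun τ : ℍ ↦ (-2 + etaQuotient 44 rV44 τ - 2 * etaQuotient 44 rU44 τ) ^ 2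
      - ((4 / 3 : ℂ) + etaQuotient 44 rU44 τ) ^ 3 - (8 / 3 : ℂ) * ((4 / 3 : ℂ) + etaQuotient 44 rU44 τ) + 52 / 27) atImInfty (𝓝 0) := by
  have h := (tendsto_cubicDefect44.mul (tendsto_qParam.pow 27)).const_mul (-(1 / 27 : ℂ))
  rw [zero_mul, mul_zero] at h
  refine h.congr fun τ ↦ ?_
  have hq := qParam_ne_zero τ
  simp only [eval_mul, eval_pow, eval_X, eval_ofNat]
  field_simp
  ring

/-- **(I1)₄₄: `Y² = X³ + (8/3)X − 52/27` on `ℍ`, exactly**: the derivative of `Y² − X³ − (8/3)X + 52/27` is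
`2YY′ − (3X² + 8/3)X′ = 0` by (I2a), (I2b); `ℍ` is connected; the constant is `0` by (L3). [cite: CremonaAlgorithms1997, Table 1 (44a1)] -/
theorem cubic_fortyFour (τ : ℍ) :
    (-2 + etaQuotient 44 rV44 τ - 2 * etaQuotient 44 rU44 τ) ^ 2
      = ((4 / 3 : ℂ) + etaQuotient 44 rU44 τ) ^ 3 + (8 / 3 : ℂ) * ((4 / 3 : ℂ) + etaQuotient 44 rU44 τ) - 52 / 27 := by
  have hxall := deriv_X_fortyFour
  have hyall := deriv_Y_fortyFour
  set U : ℍ → ℂ := etaQuotient 44 rU44 with hU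
  set V : ℍ → ℂ := etaQuotient 44 rV44 with hV
  have hUd := UpperHalfPlane.mdifferentiable_iff.mp (mdifferentiable_etaQuotient 44 rU44)
  have hVd := UpperHalfPlane.mdifferentiable_iff.mp (mdifferentiable_etaQuotient 44 rV44)
  -- the defect as a function on `ℂ`
  set Df : ℂ → ℂ := fun z ↦ (-2 + (V ∘ ofComplex) z - 2 * (U ∘ ofComplex) z) ^ 2
      - ((4 / 3 : ℂ) + (U ∘ ofComplex) z) ^ 3 - (8 / 3 : ℂ) * ((4 / 3 : ℂ) + (U ∘ ofComplex) z) + 52 / 27 with hDf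
  have hderiv : ∀ z ∈ {z : ℂ | 0 < z.im}, deriv Df z = 0 := by
    intro z hz
    have h1 : HasDerivAt (U ∘ ofComplex) (deriv (U ∘ ofComplex) z) z :=
      ((hUd z hz).differentiableAt (isOpen_upperHalfPlaneSet.mem_nhds hz)).hasDerivAt
    have h2 : HasDerivAt (V ∘ ofComplex) (deriv (V ∘ ofComplex) z) z :=
      ((hVd z hz).differentiableAt (isOpen_upperHalfPlaneSet.mem_nhds hz)).hasDerivAt
    have hX' : HasDerivAt (fun w : ℂ ↦ (4 / 3 : ℂ) + (U ∘ ofComplex) w) (deriv (U ∘ ofComplex) z) z :=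
      h1.const_add (4 / 3 : ℂ)
    have hY' := (h2.const_add (-2 : ℂ)).sub (h1.const_mul (2 : ℂ))
    have hPd := (((hY'.pow 2).sub (hX'.pow 3)).sub (hX'.const_mul (8 / 3 : ℂ))).add_const (52 / 27 : ℂ)
    have hfunP : Df = fun w ↦ ((((fun w : ℂ ↦ -2 + (V ∘ ofComplex) w) - fun w : ℂ ↦ 2 * (U ∘ ofComplex) w) ^ 2
        - (fun w : ℂ ↦ (4 / 3 : ℂ) + (U ∘ ofComplex) w) ^ 3
        - fun w ↦ (8 / 3 : ℂ) * ((4 / 3 : ℂ) + (U ∘ ofComplex) w)) w + 52 / 27) := by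
      funext w
      simp only [hDf, Pi.sub_apply, Pi.pow_apply]
    rw [hfunP, hPd.deriv]
    have hx' := hxall ⟨z, hz⟩
    have hy' := hyall ⟨z, hz⟩
    have hcoe : ((⟨z, hz⟩ : ℍ) : ℂ) = z := rfl
    have hfx : ((fun σ : ℍ ↦ (4 / 3 : ℂ) + U σ) ∘ ofComplex) = fun w ↦ (4 / 3 : ℂ) + (U ∘ ofComplex) w := by
      funext w
      simp only [Function.comp_apply]
    have hfy : ((fun σ : ℍ ↦ -2 + V σ - 2 * U σ) ∘ ofComplex)
        = ((fun w ↦ -2 + (V ∘ ofComplex) w) - fun w ↦ 2 * (U ∘ ofComplex) w) := by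
      funext w
      simp only [Function.comp_apply, Pi.sub_apply]
    rw [hfx, hcoe, deriv_const_add] at hx'
    rw [hfy, hcoe, hY'.deriv] at hy'
    rw [hy', hx']
    simp only [Function.comp_apply, Pi.sub_apply, ofComplex_apply_of_im_pos hz, show (3 : ℕ) - 1 = 2 from rfl,
      show (2 : ℕ) - 1 = 1 from rfl]
    push_cast
    ring
  have hPdiff : DifferentiableOn ℂ Df {z : ℂ | 0 < z.im} := by
    have hXd : DifferentiableOn ℂ (fun w : ℂ ↦ (4 / 3 : ℂ) + (U ∘ ofComplex) w) {z : ℂ | 0 < z.im} := hUd.const_add _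
    have hYd : DifferentiableOn ℂ (fun w : ℂ ↦ -2 + (V ∘ ofComplex) w - 2 * (U ∘ ofComplex) w) {z : ℂ | 0 < z.im} :=
      (hVd.const_add _).sub (hUd.const_mul _)
    exact (((hYd.pow 2).sub (hXd.pow 3)).sub (hXd.const_mul _)).add_const _
  have hconst : ∀ z ∈ {z : ℂ | 0 < z.im}, ∀ w ∈ {z : ℂ | 0 < z.im}, Df z = Df w :=
    fun z hz w hw ↦ isOpen_upperHalfPlaneSet.is_const_of_deriv_eq_zero convex_setOf_im_pos.isPreconnected hPdiff hderiv hz hw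
  have hlim : Tendsto (fun σ : ℍ ↦ (-2 + V σ - 2 * U σ) ^ 2 - ((4 / 3 : ℂ) + U σ) ^ 3 - (8 / 3 : ℂ) * ((4 / 3 : ℂ) + U σ) + 52 / 27)
      atImInfty (𝓝 ((-2 + V τ - 2 * U τ) ^ 2 - ((4 / 3 : ℂ) + U τ) ^ 3 - (8 / 3 : ℂ) * ((4 / 3 : ℂ) + U τ) + 52 / 27)) := by
    refine tendsto_const_nhds.congr fun σ ↦ ?_
    have h := hconst _ τ.im_pos _ σ.im_pos
    simp only [hDf, Function.comp_apply, ofComplex_apply] at h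
    exact h
  have h0 := tendsto_nhds_unique hlim tendsto_cubicLimit_fortyFour
  linear_combination h0

/-! ## §3 (S2)₄₄: `Λ(φ) ⊆ Λ(−32/3, 208/27)` for every `φ ∈ S₂(Γ₀(44))` with `⇑φ = Φ₄₄` -/

/-- `X = 4/3 + u₄₄` is `Γ₀(44)`-invariant. [cite: Ligozat1975, Ch. 3] -/
theorem X_smul44 (γ : Gamma0 44) (τ : ℍ) :
    (4 / 3 : ℂ) + etaQuotient 44 rU44 ((γ : SL(2, ℤ)) • τ) = (4 / 3 : ℂ) + etaQuotient 44 rU44 τ := by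
  rw [u44_smul _ γ.2 τ]

/-- **Non-degeneracy: `q³·Y → 1` at `i∞`**, so `Y ≠ 0` somewhere (indeed near `i∞`). [folklore] -/
theorem tendsto_qcube_mul_Y :
    Tendsto (fun τ : ℍ ↦ Function.Periodic.qParam 1 (τ : ℂ) ^ 3 * (-2 + etaQuotient 44 rV44 τ - 2 * etaQuotient 44 rU44 τ))
      atImInfty (𝓝 1) := by
  have hv := QRemainder.tendsto_eval_zero tendsto_qpow_mul_v44
  have hu := QRemainder.tendsto_eval_zero tendsto_qpow_mul_u44
  have hq := tendsto_qParam
  have h := ((hq.pow 3).const_mul (-2 : ℂ)).add (hv.sub ((hq.mul hu).const_mul 2))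
  have e1 : ((-2 : ℂ) * 0 ^ 3 + ((1 + 2 * X - X ^ 2 - 2 * X ^ 3 + 3 * X ^ 4 + 2 * X ^ 5 - 4 * X ^ 6 - 4 * X ^ 7 + 5 * X ^ 8 + 8 * X ^ 9 - 8 * X ^ 10 - 8 * X ^ 11 + 15 * X ^ 12 + 10 * X ^ 13 - 19 * X ^ 14 - 12 * X ^ 15 + 26 * X ^ 16 + 18 * X ^ 17 - 37 * X ^ 18 - 24 * X ^ 19 + 54 * X ^ 20 + 26 * X ^ 21 - 72 * X ^ 22 - 36 * X ^ 23 + 91 * X ^ 24 + 50 * X ^ 25 - 124 * X ^ 26 - 56 * X ^ 27 + 165 * X ^ 28 + 66 * X ^ 29 - 212 * X ^ 30 - 88 * X ^ 31 + 268 * X ^ 32 + 108 * X ^ 33 : ℂ[X]).eval 0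
      - 2 * (0 * (1 - 2 * X ^ 2 + X ^ 4 - 2 * X ^ 6 + 4 * X ^ 8 - 4 * X ^ 10 + 5 * X ^ 12 - 6 * X ^ 14 + 9 * X ^ 16 - 12 * X ^ 18 + 13 * X ^ 20 - 18 * X ^ 22 + 25 * X ^ 24 - 28 * X ^ 26 + 33 * X ^ 28 - 44 * X ^ 30 + 54 * X ^ 32 : ℂ[X]).eval 0))) = 1 := by
    simp
  rw [e1] at h
  refine h.congr fun τ ↦ ?_
  ring

/-- **(S2)₄₄ unconditionally: every period of `φ` lies in the lattice with invariants `g₂ = −32/3 = c₄(44a1)/12`,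
`g₃ = 208/27 = c₆(44a1)/216`** — for every `φ ∈ S₂(Γ₀(44))`, `φ ≠ 0`, whose underlying function is `Φ₄₄` (analytic bridge
with `(X′)² = (2πiφ)²(4X³ + (32/3)X − 208/27)` from (I1)₄₄, (I2a)₄₄; non-degeneracy from `q³Y → 1`). [cite: CremonaAlgorithms1997, §2.10] -/
theorem periodLatticeLe_fortyFour (φ : CuspForm (Gamma0 44) 2) (hφ0 : φ ≠ 0) (hφ : (⇑φ : ℍ → ℂ) = ⇑Phi44) :
    ∃ L₁ : PeriodPair, L₁.g₂ = -32 / 3 ∧ L₁.g₃ = 208 / 27 ∧ ∀ z ∈ periodLattice φ, z ∈ L₁.lattice := by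
  obtain ⟨L₁, hg2, hg3⟩ := PeriodPair.uniformization_holds (-32 / 3) (208 / 27) (by norm_num)
  have hxd : MDifferentiable 𝓘(ℂ) 𝓘(ℂ) (fun σ : ℍ ↦ (4 / 3 : ℂ) + etaQuotient 44 rU44 σ) :=
    mdifferentiable_const.add (mdifferentiable_etaQuotient 44 _)
  -- a non-degenerate point: `q³Y → 1`, so `Y τ₀ ≠ 0` for some `τ₀`
  obtain ⟨τ₀, hτ₀⟩ := (tendsto_qcube_mul_Y.eventually_ne one_ne_zero).exists
  have hY0 : -2 + etaQuotient 44 rV44 τ₀ - 2 * etaQuotient 44 rU44 τ₀ ≠ 0 := fun h ↦ hτ₀ (by rw [h, mul_zero])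
  refine ⟨L₁, hg2, hg3, periodLattice_le_of_deriv_sq φ hφ0 L₁
    (fun σ : ℍ ↦ (4 / 3 : ℂ) + etaQuotient 44 rU44 σ) hxd X_smul44 ?_ ⟨τ₀, ?_⟩⟩
  · intro τ
    rw [deriv_X_fortyFour τ, hg2, hg3, hφ]
    linear_combination 4 * (2 * π * I * Phi44 τ) ^ 2 * cubic_fortyFour τ
  · rw [hg2, hg3]
    intro h
    apply hY0
    have hc := cubic_fortyFour τ₀
    have : (-2 + etaQuotient 44 rV44 τ₀ - 2 * etaQuotient 44 rU44 τ₀) ^ 2 = 0 := by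
      linear_combination hc + (1 / 4 : ℂ) * h
    exact pow_eq_zero_iff two_ne_zero |>.mp this

end Summit.BirchSwinnertonDyer.BirchSwinnertonDyer.Theorems.ManinLocalTwoThree.LevelFortyFour

end
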